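import Mathlib
import HarnessLib
import Summits.HubbardSuperconductivity.HubbardSuperconductivity.Theses.LiebTwin
import Summits.HubbardSuperconductivity.HubbardSuperconductivity.Theorems.EnslavedA1gLowerSandwich
import Summits.HubbardSuperconductivity.HubbardSuperconductivity.Theorems.LiebTwinNoOnsiteODLROProjectedAddition
import Summits.HubbardSuperconductivity.HubbardSuperconductivity.Theorems.LiebTwinNoOnsiteODLROKineticPairWindow
import Literature.MathematicalPhysics.QuantumLattice.TorusBandFillingWindow
import Literature.MathematicalPhysics.QuantumLattice.FreeFermionSectorEnergyDeviation

/-!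
# Crux `NoOnsiteODLRO` (stmt-HubbardSuperconductivity-0933): the strict pair window at WEAK coupling

Repulsive Hubbard model `H = hubbardTorus 2 L 1 U = T + U·D` on `(ℤ/Lℤ)²`; `E(a,b)` the bottom of Lieb's sector
`(N↑, N↓) = (a, b)`. MOMENTUM-SPACE ADDITION: for a Bloch mode `c†_{kσ}` (`momentumCreation`),
`[H, c†_{kσ}] = ε_L(k) c†_{kσ} + U R_k` with `R_k = L⁻¹ Σ_x χ_k(x) c†_{xσ} n_{xσ̄}`, `{R_k, R_kᴴ} = L⁻² Σ_x n_{xσ̄} ≤ 1`,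
so on a sector ground state `φ` the trial vector `w = c†_{kσ}φ` has `Re⟨w, Hw⟩ ≤ (E(a,b) + ε_L(k))‖w‖² + U‖w‖‖φ‖`.
By Parseval per spin at most `N_σ` modes below a level `μ` are Pauli blocked, so if `#{k : ε_L(k) ≤ μ} ≥ N_σ + L²/256`
one addition costs `≤ μ + 16U`. At `μ₂ = -4 sin²(π/50) < 0` the integrated density of states is `≥ 287/625`
(`le_volume_real_sublevelCell_hi`) while the filling per spin is `≤ (1-δ)/2 ≤ 9/20` for `δ ≥ 1/10`; the Weyl law
(`tendsto_torusLevelCount_div_sq`) gives the room for large `L`, whence `E(N,0) - E(N-2,0) ≤ 2μ₂ + 32U` and the window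
`U - (E(N,0) - E(N-2,0)) ≥ -μ₂ > 0` for `0 ≤ U ≤ -μ₂/31` (registered stub `stub_weakCouplingPairWindow`; compare the
large-`U` window of `LiebTwinNoOnsiteODLROLargeUCondensateBound`). Yang, PRL 63 (1989) 2144; Lieb–Loss–McCann,
J. Math. Phys. 34 (1993) 891; Tasaki (2020) §2.1; Essler et al. (2005) §2.1. Folklore bookkeeping; no definitions.
-/
noncomputable section

namespace Summit.HubbardSuperconductivity.NoOnsiteODLRO.WeakCoupling

open Matrix Finset Filter
open scoped ComplexOrder
open Literature.Probability.LatticeModels Literature.MathematicalPhysics.QuantumLattice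
open Summit.HubbardSuperconductivity.HubbardSuperconductivity.Theorems.EnslavedA1g

/-! ### The smeared dressed creation `R_g = Σ_x g(x) c†_{xτ} n_{xτ'}` on a finite lattice -/

section Dressed

variable {Λ : Type*} [LinearOrder Λ] [Fintype Λ]

/-- `{c†_{xτ} n_{xτ'}, n_{yτ'} c_{yτ}} = δ_{xy} n_{xτ'}` for `τ' ≠ τ` (the `n_{zτ'}` commute with everything of
spin `τ`, `{c†_{xτ}, c_{yτ}} = δ_{xy}`, `n² = n`). Essler et al. (2005) §2.1. [folklore] -/
theorem dressedCreation_anticomm (x y : Λ) {τ τ' : Fin 2} (hne : τ' ≠ τ) :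
    creation (orb x τ) * numberOp x τ' * (numberOp y τ' * annihilation (orb y τ)) +
        numberOp y τ' * annihilation (orb y τ) * (creation (orb x τ) * numberOp x τ') =
      if x = y then numberOp x τ' else 0 := by
  have hna : ∀ z : Λ, numberOp z τ' * annihilation (orb y τ) = annihilation (orb y τ) * numberOp z τ' :=
    fun z => numberOp_mul_annihilation_of_ne fun h => hne (orb_eq_orb_iff.1 h).2
  have hnc : ∀ z : Λ, numberOp z τ' * creation (orb x τ) = creation (orb x τ) * numberOp z τ' := fun z => by
    have h := numberOp_commutator_creation z x τ' τ
    rw [if_neg (fun h' => hne h'.1.symm)] at h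
    exact sub_eq_zero.1 h
  have hR1 : ∀ (z : Λ) (M : Matrix (Finset (Orb Λ)) (Finset (Orb Λ)) ℂ),
      creation (orb x τ) * (numberOp z τ' * M) = numberOp z τ' * (creation (orb x τ) * M) := fun z M => by
    rw [← Matrix.mul_assoc, ← hnc z, Matrix.mul_assoc]
  have hR2 : ∀ (z : Λ) (M : Matrix (Finset (Orb Λ)) (Finset (Orb Λ)) ℂ),
      annihilation (orb y τ) * (numberOp z τ' * M) = numberOp z τ' * (annihilation (orb y τ) * M) := fun z M => by
    rw [← Matrix.mul_assoc, ← hna z, Matrix.mul_assoc]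
  have hR3 : ∀ M : Matrix (Finset (Orb Λ)) (Finset (Orb Λ)) ℂ,
      numberOp y τ' * (numberOp x τ' * M) = numberOp x τ' * (numberOp y τ' * M) := fun M => by
    rw [← Matrix.mul_assoc, show numberOp y τ' * numberOp x τ' = numberOp x τ' * numberOp y τ' from
      (numberAt_commute (orb y τ') (orb x τ')).eq, Matrix.mul_assoc]
  have hCAR : creation (orb x τ) * annihilation (orb y τ) + annihilation (orb y τ) * creation (orb x τ) =
      if x = y then (1 : Matrix (Finset (Orb Λ)) (Finset (Orb Λ)) ℂ) else 0 := by
    rw [add_comm, annihilation_mul_creation_add_creation_mul_annihilation_holds (orb y τ) (orb x τ)]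
    by_cases hxy : x = y
    · rw [if_pos hxy, if_pos (by rw [hxy])]
    · rw [if_neg hxy, if_neg (fun h => hxy (orb_eq_orb_iff.1 h).1.symm)]
  simp only [Matrix.mul_assoc, hR1, ← hnc, hR2, hR3]
  rw [← Matrix.mul_add, ← Matrix.mul_add, hCAR]
  split_ifs with hxy
  · subst hxy
    rw [Matrix.mul_one, ← numberAt_orb]
    exact numberAt_idempotent _
  · rw [Matrix.mul_zero, Matrix.mul_zero]

/-- **`{R_g, R_gᴴ} = Σ_x |g(x)|² n_{xτ'}`** for `R_g = Σ_x g(x) c†_{xτ} n_{xτ'}`, `τ' ≠ τ`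
(`R_gᴴ = Σ_x conj g(x) n_{xτ'} c_{xτ}`). Essler et al. (2005) §2.1 (CAR bookkeeping). [folklore] -/
theorem dressedSum_anticomm (g : Λ → ℂ) {τ τ' : Fin 2} (hne : τ' ≠ τ) :
    (∑ x : Λ, g x • (creation (orb x τ) * numberOp x τ')) *
          (∑ x : Λ, star (g x) • (numberOp x τ' * annihilation (orb x τ))) +
        (∑ x : Λ, star (g x) • (numberOp x τ' * annihilation (orb x τ))) *
          (∑ x : Λ, g x • (creation (orb x τ) * numberOp x τ')) =
      ∑ x : Λ, ((‖g x‖ ^ 2 : ℝ) : ℂ) • (numberOp x τ' : Matrix (Finset (Orb Λ)) (Finset (Orb Λ)) ℂ) := by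
  rw [Finset.sum_mul_sum, Finset.sum_mul_sum, Finset.sum_comm (s := (univ : Finset Λ))
    (t := (univ : Finset Λ)) (f := fun y x => star (g y) • (numberOp y τ' * annihilation (orb y τ)) *
      (g x • (creation (orb x τ) * numberOp x τ'))), ← Finset.sum_add_distrib]
  refine Finset.sum_congr rfl fun x _ => ?_
  rw [← Finset.sum_add_distrib]
  have hterm : ∀ y : Λ, g x • (creation (orb x τ) * numberOp x τ') *
        (star (g y) • (numberOp y τ' * annihilation (orb y τ))) +
      star (g y) • (numberOp y τ' * annihilation (orb y τ)) * (g x • (creation (orb x τ) * numberOp x τ')) =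
      if x = y then ((‖g x‖ ^ 2 : ℝ) : ℂ) • (numberOp x τ' : Matrix (Finset (Orb Λ)) (Finset (Orb Λ)) ℂ)
        else 0 := by
    intro y
    rw [smul_mul_smul_comm, smul_mul_smul_comm, mul_comm (star (g y)) (g x), ← smul_add,
      dressedCreation_anticomm x y hne]
    split_ifs with hxy
    · subst hxy
      congr 1
      rw [Complex.star_def, Complex.mul_conj, Complex.normSq_eq_norm_sq]
    · rw [smul_zero]
  simp only [hterm, Finset.sum_ite_eq, Finset.mem_univ, if_true]

/-- **Norm bound for the smeared dressed creation**: `‖R_g φ‖² ≤ (Σ_x |g(x)|²) ‖φ‖²` for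
`R_g = Σ_x g(x) c†_{xτ} n_{xτ'}`, `τ' ≠ τ` (`R_gᴴR_g ≤ {R_g, R_gᴴ} = Σ_x |g(x)|² n_{xτ'} ≤ Σ_x |g(x)|²`). [folklore] -/
theorem re_inner_dressedSum_mulVec_le (g : Λ → ℂ) {τ τ' : Fin 2} (hne : τ' ≠ τ) (φ : Fock (Orb Λ)) :
    (star ((∑ x : Λ, g x • (creation (orb x τ) * numberOp x τ')) *ᵥ φ) ⬝ᵥ
        ((∑ x : Λ, g x • (creation (orb x τ) * numberOp x τ')) *ᵥ φ)).re ≤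
      (∑ x : Λ, ‖g x‖ ^ 2) * (star φ ⬝ᵥ φ).re := by
  set R : Matrix (Finset (Orb Λ)) (Finset (Orb Λ)) ℂ := ∑ x : Λ, g x • (creation (orb x τ) * numberOp x τ')
  set R' : Matrix (Finset (Orb Λ)) (Finset (Orb Λ)) ℂ :=
    ∑ x : Λ, star (g x) • (numberOp x τ' * annihilation (orb x τ))
  have hRct : Rᴴ = R' := by
    rw [conjTranspose_sum]
    refine Finset.sum_congr rfl fun x _ => ?_
    rw [conjTranspose_smul, conjTranspose_mul, creation_conjTranspose, ← numberAt_orb, (numberAt_isHermitian _).eq]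
  have h1 : star (R *ᵥ φ) ⬝ᵥ (R *ᵥ φ) = star φ ⬝ᵥ ((R' * R) *ᵥ φ) := by
    rw [← EnslavedA1g.star_dotProduct_conjTranspose_mulVec, hRct, mulVec_mulVec]
  have h2 : star (R' *ᵥ φ) ⬝ᵥ (R' *ᵥ φ) = star φ ⬝ᵥ ((R * R') *ᵥ φ) := by
    rw [← EnslavedA1g.star_dotProduct_conjTranspose_mulVec, show R'ᴴ = R by rw [← hRct, conjTranspose_conjTranspose],
      mulVec_mulVec]
  have hsum : (star φ ⬝ᵥ ((R * R' + R' * R) *ᵥ φ)).re = ∑ x : Λ, ‖g x‖ ^ 2 * (star φ ⬝ᵥ (numberOp x τ' *ᵥ φ)).re := by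
    rw [show R * R' + R' * R = _ from dressedSum_anticomm g hne, Matrix.sum_mulVec, dotProduct_sum, Complex.re_sum]
    refine Finset.sum_congr rfl fun x _ => ?_
    rw [Matrix.smul_mulVec, dotProduct_smul, smul_eq_mul, Complex.re_ofReal_mul]
  have hnle : ∀ x : Λ, (star φ ⬝ᵥ (numberOp x τ' *ᵥ φ)).re ≤ (star φ ⬝ᵥ φ).re := fun x =>
    Literature.Computability.AlgebraicComplexity.re_dotProduct_mulVec_le
      (by rw [← numberAt_orb]; exact numberAt_isHermitian _) (by rw [← numberAt_orb]; exact numberAt_idempotent _) φ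
  calc (star (R *ᵥ φ) ⬝ᵥ (R *ᵥ φ)).re
      ≤ (star (R *ᵥ φ) ⬝ᵥ (R *ᵥ φ)).re + (star (R' *ᵥ φ) ⬝ᵥ (R' *ᵥ φ)).re :=
        le_add_of_nonneg_right (UpperSandwich.re_star_dotProduct_self_nonneg _)
    _ = (star φ ⬝ᵥ ((R * R' + R' * R) *ᵥ φ)).re := by
        rw [h1, h2, Matrix.add_mulVec, dotProduct_add, Complex.add_re, add_comm]
    _ = ∑ x : Λ, ‖g x‖ ^ 2 * (star φ ⬝ᵥ (numberOp x τ' *ᵥ φ)).re := hsum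
    _ ≤ ∑ x : Λ, ‖g x‖ ^ 2 * (star φ ⬝ᵥ φ).re :=
        Finset.sum_le_sum fun x _ => mul_le_mul_of_nonneg_left (hnle x) (sq_nonneg _)
    _ = (∑ x : Λ, ‖g x‖ ^ 2) * (star φ ⬝ᵥ φ).re := by rw [Finset.sum_mul]

end Dressed

section Torus

variable {L : ℕ} [NeZero L]

/-- **`[H(1,U), c†_{kτ}] = ε_L(k) c†_{kτ} + U · L⁻¹Σ_x χ_k(x) c†_{xτ} n_{xτ'}`** on the torus of side `L ≥ 3`
(`τ' ≠ τ`): `H(1,0) = Σ_{k'σ} ε_L(k') n_{k'σ}` with `[n_{k'σ}, c†_{kτ}] = δ c†_{kτ}` (BGM 2006 §2.1), and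
`[Σ_x n_{x↑}n_{x↓}, c†_{xτ}] = c†_{xτ} n_{xτ'}` (Essler et al. (2005) §2.1). [folklore] -/
theorem hamiltonian_commutator_momentumCreation (hL : 3 ≤ L) (U : ℝ) (k : TorusSite 2 L)
    {τ τ' : Fin 2} (hne : τ' ≠ τ) :
    hubbardTorus 2 L 1 U * momentumCreation k τ - momentumCreation k τ * hubbardTorus 2 L 1 U =
      ((torusBand L k : ℝ) : ℂ) • momentumCreation k τ +
        (U : ℂ) • ∑ x : FermionTorus 2 L, (torusFourierWeight 2 L * torusChar k x.toTorusSite) •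
          (creation (orb x τ) * numberOp x τ') := by
  -- kinetic part
  have hcomm : ∀ (k' : TorusSite 2 L) (σ : Fin 2),
      momentumNumber k' σ * momentumCreation k τ - momentumCreation k τ * momentumNumber k' σ =
        if σ = τ then (if k' = k then momentumCreation k τ else 0) else 0 := by
    intro k' σ
    by_cases h : k' = k ∧ σ = τ
    · obtain ⟨rfl, rfl⟩ := h
      rw [if_pos rfl, if_pos rfl, momentumNumber_mul_momentumCreation_self, momentumNumber, ← Matrix.mul_assoc,
        momentumCreation_mul_self, Matrix.zero_mul, sub_zero]
    · rw [momentumNumber_mul_momentumCreation_of_ne h, sub_self]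
      split_ifs with h1 h2
      · exact absurd ⟨h2, h1⟩ h
      · rfl
      · rfl
  have hT : hubbardTorus 2 L 1 0 * momentumCreation k τ - momentumCreation k τ * hubbardTorus 2 L 1 0 =
      ((torusBand L k : ℝ) : ℂ) • momentumCreation k τ := by
    rw [hubbardTorus_zero_eq_sum_momentumNumber hL]
    simp only [Finset.sum_mul, Finset.mul_sum, Matrix.smul_mul, Matrix.mul_smul, ← Finset.sum_sub_distrib,
      ← smul_sub, hcomm, smul_ite, smul_zero, Finset.sum_ite_eq', Finset.mem_univ, if_true]
  -- interaction part
  have hD : (∑ x : FermionTorus 2 L, numberOp x 0 * numberOp x 1) * momentumCreation k τ -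
      momentumCreation k τ * ∑ x : FermionTorus 2 L, numberOp x 0 * numberOp x 1 =
      ∑ x : FermionTorus 2 L, (torusFourierWeight 2 L * torusChar k x.toTorusSite) •
        (creation (orb x τ) * numberOp x τ') := by
    rw [momentumCreation_eq_sum, Finset.mul_sum, Finset.sum_mul, ← Finset.sum_sub_distrib]
    refine Finset.sum_congr rfl fun x _ => ?_
    rw [Matrix.mul_smul, Matrix.smul_mul, ← smul_sub,
      Summit.HubbardSuperconductivity.NoOnsiteODLRO.LargeU.interaction_commutator_creation x hne]
  have hH : hubbardTorus 2 L 1 U = hubbardTorus 2 L 1 0 + (U : ℂ) • ∑ x : FermionTorus 2 L, numberOp x 0 * numberOp x 1 :=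
    Summit.HubbardSuperconductivity.HubbardSuperconductivity.Theorems.hamiltonian_eq_add_smul_doublon _ 1 U
  rw [hH, Matrix.add_mul, Matrix.mul_add, Matrix.smul_mul, Matrix.mul_smul, add_sub_add_comm, ← smul_sub, hT, hD]

/-- **The momentum addition step.** `H = hubbardTorus 2 L 1 U`, `U ≥ 0`, `L ≥ 3`; `φ ≠ 0` an EIGENVECTOR
(`Hφ = E'φ`); the trial vector `w = c†_{kτ}φ` lies in a sector on which `E‖v‖² ≤ Re⟨v, Hv⟩` and has the Pauli
room `‖w‖² ≥ β²‖φ‖²`, `β > 0`. Then `E ≤ E' + ε_L(k) + U/β`: `Re⟨w, Hw⟩ = (E' + ε_L(k))‖w‖² + U Re⟨w, R_kφ⟩` with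
`‖R_kφ‖ ≤ ‖φ‖ ≤ ‖w‖/β` (`hamiltonian_commutator_momentumCreation`, `re_inner_dressedSum_mulVec_le`,
`Σ_x |L⁻¹χ_k(x)|² = 1`). Tasaki (2020) §2.1; Yang, PRL 63 (1989) 2144. [folklore] -/
theorem momentum_addition_step (hL : 3 ≤ L) {U : ℝ} (hU : 0 ≤ U) {τ τ' : Fin 2} (hne : τ' ≠ τ)
    (k : TorusSite 2 L) {a' b' : ℕ} {φ : Fock (Orb (FermionTorus 2 L))} (hφ0 : φ ≠ 0) {E' : ℝ}
    (hHφ : hubbardTorus 2 L 1 U *ᵥ φ = ((E' : ℝ) : ℂ) • φ) (hup : IsInSector a' b' (momentumCreation k τ *ᵥ φ))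
    {E : ℝ} (hE : ∀ w : Fock (Orb (FermionTorus 2 L)), IsInSector a' b' w →
      E * (star w ⬝ᵥ w).re ≤ (star w ⬝ᵥ (hubbardTorus 2 L 1 U *ᵥ w)).re)
    {β : ℝ} (hβ : 0 < β) (hroom : β ^ 2 * (star φ ⬝ᵥ φ).re ≤
      (star (momentumCreation k τ *ᵥ φ) ⬝ᵥ (momentumCreation k τ *ᵥ φ)).re) :
    E ≤ E' + torusBand L k + U / β := by
  set H := hubbardTorus 2 L 1 U
  set C := momentumCreation (d := 2) (L := L) k τ
  set g : FermionTorus 2 L → ℂ := fun x => torusFourierWeight 2 L * torusChar k x.toTorusSite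
  set R : Matrix (Finset (Orb (FermionTorus 2 L))) (Finset (Orb (FermionTorus 2 L))) ℂ :=
    ∑ x : FermionTorus 2 L, g x • (creation (orb x τ) * numberOp x τ')
  set w : Fock (Orb (FermionTorus 2 L)) := C *ᵥ φ with hw
  -- `H w = (E' + ε) w + U R φ`, so `Re⟨w, Hw⟩ = (E' + ε)‖w‖² + U Re⟨w, Rφ⟩`
  have hHw : H *ᵥ w = ((E' + torusBand L k : ℝ) : ℂ) • w + (U : ℂ) • (R *ᵥ φ) := by
    have h1 : H *ᵥ w = (H * C - C * H) *ᵥ φ + C *ᵥ (H *ᵥ φ) := by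
      rw [sub_mulVec, hw, mulVec_mulVec, mulVec_mulVec]; abel
    rw [h1, show H * C - C * H = _ from hamiltonian_commutator_momentumCreation hL U k hne, hHφ, mulVec_smul,
      add_mulVec, Matrix.smul_mulVec, Matrix.smul_mulVec, ← hw, Complex.ofReal_add, add_smul]
    abel
  have hen : (star w ⬝ᵥ (H *ᵥ w)).re = (E' + torusBand L k) * (star w ⬝ᵥ w).re + U * (star w ⬝ᵥ (R *ᵥ φ)).re := by
    rw [hHw, dotProduct_add, dotProduct_smul, dotProduct_smul, Complex.add_re, smul_eq_mul, smul_eq_mul,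
      Complex.re_ofReal_mul, Complex.re_ofReal_mul]
  -- norms: `β‖φ‖ ≤ ‖w‖`, `‖Rφ‖ ≤ ‖φ‖` (`Σ_x |g(x)|² = L² · L⁻² = 1`)
  have hφsq : eucNorm φ ^ 2 = (star φ ⬝ᵥ φ).re := eucNorm_sq φ
  have hφn : 0 < eucNorm φ := by
    have hpos : 0 < (star φ ⬝ᵥ φ).re := (Complex.pos_iff.mp (dotProduct_star_self_pos_iff.2 hφ0)).1
    have hne0 : eucNorm φ ≠ 0 := fun h => by rw [h] at hφsq; norm_num at hφsq; linarith
    exact lt_of_le_of_ne (eucNorm_nonneg φ) (Ne.symm hne0)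
  have hβle : β * eucNorm φ ≤ eucNorm w := by
    have h : (β * eucNorm φ) ^ 2 ≤ eucNorm w ^ 2 := by rw [mul_pow, hφsq, eucNorm_sq]; exact hroom
    exact (pow_le_pow_iff_left₀ (by positivity) (eucNorm_nonneg _) two_ne_zero).1 h
  have hg : ∑ x : FermionTorus 2 L, ‖g x‖ ^ 2 = 1 := by
    have h : ∀ x : FermionTorus 2 L, ‖g x‖ ^ 2 = (((L : ℝ) ^ 2)⁻¹ : ℝ) := fun x => by
      simp only [g]
      rw [norm_mul, norm_torusChar, mul_one, torusFourierWeight_two, norm_inv, Complex.norm_natCast, inv_pow]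
    rw [Finset.sum_congr rfl (fun x _ => h x), Finset.sum_const, Finset.card_univ, card_fermionTorus,
      nsmul_eq_mul, Nat.cast_pow]
    exact mul_inv_cancel₀ (pow_ne_zero 2 (Nat.cast_ne_zero.2 (NeZero.ne L)))
  have hRle : eucNorm (R *ᵥ φ) ≤ eucNorm φ := by
    have h := re_inner_dressedSum_mulVec_le g hne φ
    rw [hg, one_mul, ← eucNorm_sq, ← eucNorm_sq] at h
    exact (pow_le_pow_iff_left₀ (eucNorm_nonneg _) (eucNorm_nonneg _) two_ne_zero).1 h
  have hcross : (star w ⬝ᵥ (R *ᵥ φ)).re ≤ eucNorm w * eucNorm φ := (Complex.re_le_norm _).trans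
    ((norm_star_dotProduct_le _ _).trans (mul_le_mul_of_nonneg_left hRle (eucNorm_nonneg _)))
  -- combine with the variational bound `E‖w‖² ≤ Re⟨w, Hw⟩`
  have key : (E - E' - torusBand L k) * eucNorm w ^ 2 ≤ U / β * eucNorm w ^ 2 := by
    have h1 : (E - E' - torusBand L k) * eucNorm w ^ 2 ≤ U * (eucNorm w * eucNorm φ) := by
      rw [eucNorm_sq]; nlinarith [hE w hup, hen, hcross, hU]
    have h2 : eucNorm φ ≤ eucNorm w / β := by rw [le_div_iff₀ hβ]; linarith [hβle]
    calc (E - E' - torusBand L k) * eucNorm w ^ 2 ≤ U * (eucNorm w * eucNorm φ) := h1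
      _ ≤ U * (eucNorm w * (eucNorm w / β)) := mul_le_mul_of_nonneg_left (mul_le_mul_of_nonneg_left h2 (eucNorm_nonneg _)) hU
      _ = U / β * eucNorm w ^ 2 := by rw [div_eq_mul_inv, div_eq_mul_inv]; ring
  have := le_of_mul_le_mul_right key (pow_pos (lt_of_lt_of_le (mul_pos hβ hφn) hβle) 2)
  linarith

/-- **Pauli room in momentum space.** For `φ` in Lieb's sector `(a, b)` and a set `S` of momenta,
`Σ_{k∈S} ‖c†_{kτ}φ‖² ≥ (|S| - n_τ)‖φ‖²`, `n_↑ = a`, `n_↓ = b`: `‖c†_{kτ}φ‖² = ‖φ‖² - ⟨φ, n_{kτ}φ⟩` and the Bloch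
occupations of spin `τ` are nonnegative and sum to `n_τ‖φ‖²` (Parseval per spin). Bratteli–Robinson II §5.2.1.
[folklore] -/
theorem sum_re_inner_momentumCreation_mulVec_ge {a b : ℕ} {φ : Fock (Orb (FermionTorus 2 L))}
    (hφ : IsInSector a b φ) (τ : Fin 2) (S : Finset (TorusSite 2 L)) :
    ((S.card : ℝ) - ((if τ = 0 then a else b : ℕ) : ℝ)) * (star φ ⬝ᵥ φ).re ≤
      ∑ k ∈ S, (star (momentumCreation k τ *ᵥ φ) ⬝ᵥ (momentumCreation k τ *ᵥ φ)).re := by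
  have hterm : ∀ k : TorusSite 2 L, (star (momentumCreation k τ *ᵥ φ) ⬝ᵥ (momentumCreation k τ *ᵥ φ)).re =
      (star φ ⬝ᵥ φ).re - (star φ ⬝ᵥ (momentumNumber k τ *ᵥ φ)).re := fun k => by
    rw [← EnslavedA1g.star_dotProduct_conjTranspose_mulVec, momentumCreation_conjTranspose, mulVec_mulVec,
      momentumAnnihilation_mul_momentumCreation, if_pos ⟨rfl, rfl⟩,
      show momentumCreation k τ * momentumAnnihilation k τ = momentumNumber k τ from rfl,
      sub_mulVec, one_mulVec, dotProduct_sub, Complex.sub_re]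
  have htot : ∑ k : TorusSite 2 L, (star φ ⬝ᵥ (momentumNumber k τ *ᵥ φ)).re =
      ((if τ = 0 then a else b : ℕ) : ℝ) * (star φ ⬝ᵥ φ).re := by
    fin_cases τ
    · simpa only [Fin.zero_eta, Fin.isValue, if_true] using sum_re_expect_momentumNumber_up hφ
    · simpa only [Fin.mk_one, Fin.isValue, one_ne_zero, if_false] using sum_re_expect_momentumNumber_down hφ
  have hS : ∑ k ∈ S, (star φ ⬝ᵥ (momentumNumber k τ *ᵥ φ)).re ≤
      ∑ k : TorusSite 2 L, (star φ ⬝ᵥ (momentumNumber k τ *ᵥ φ)).re :=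
    Finset.sum_le_univ_sum_of_nonneg fun k => (re_expect_momentumNumber_mem_Icc k τ φ).1
  rw [Finset.sum_congr rfl (fun k _ => hterm k), Finset.sum_sub_distrib, Finset.sum_const, nsmul_eq_mul]
  rw [htot] at hS
  linarith

/-- `c†_{k↑}` maps Lieb's sector `(a, b)` into `(a + 1, b)`, and `c†_{k↓}` into `(a, b + 1)`. [folklore] -/
theorem isInSector_momentumCreation_mulVec {a b : ℕ} {φ : Fock (Orb (FermionTorus 2 L))}
    (hφ : IsInSector a b φ) (k : TorusSite 2 L) (σ : Fin 2) :
    IsInSector (if σ = 0 then a + 1 else a) (if σ = 0 then b else b + 1) (momentumCreation k σ *ᵥ φ) := by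
  rw [momentumCreation_eq_sum]
  refine isInSector_mulVec_of_shifts (a := if σ = 0 then 1 else 0) (b := if σ = 0 then 0 else 1)
    (PairChirality.Shifts.sum fun x _ => PairChirality.Shifts.smul ?_ _) ?_ ?_ hφ
  · fin_cases σ
    · exact shifts_creation_up x
    · exact shifts_creation_down x
  · split_ifs <;> push_cast <;> ring
  · split_ifs <;> push_cast <;> ring

end Torus

section Window

variable (L : ℕ) [NeZero L]

/-- **One Bloch addition costs at most `μ + 16U` in sector energy** when the level count below `μ` leaves Pauli
room: if `#{k : ε_L(k) ≤ μ} ≥ n_σ + L²/256` (`n_↑ = a`, `n_↓ = b`), `a, b ≤ L²`, `L ≥ 3`, `U ≥ 0`, then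
`E(a', b') ≤ E(a, b) + μ + 16U` for `(a', b') = (a+1, b)` (`σ = ↑`) resp. `(a, b+1)` (`σ = ↓`), `E(a,b)` the bottom
of `szSector (a+b) ((a-b)/2)` for `hubbardTorus 2 L 1 U`: by pigeonhole some mode `k` below `μ` has `‖c†_{kσ}φ‖² ≥ ‖φ‖²/256`
on a ground state `φ` of `(a, b)`, and `momentum_addition_step` applies with `β = 1/16`. [folklore] -/
theorem minEnergyOn_addOne_le_weak (hL : 3 ≤ L) {U : ℝ} (hU : 0 ≤ U) (σ : Fin 2) {a b : ℕ} (ha : a ≤ L ^ 2)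
    (hb : b ≤ L ^ 2) (μ : ℝ) (hroom : ((if σ = 0 then a else b : ℕ) : ℝ) + (L : ℝ) ^ 2 / 256 ≤ torusLevelCount L μ) :
    (hubbardTorus 2 L 1 U).minEnergyOn (szSector ((if σ = 0 then a + 1 else a) + (if σ = 0 then b else b + 1))
          ((((if σ = 0 then a + 1 else a : ℕ) : ℝ) - (if σ = 0 then b else b + 1 : ℕ)) / 2)) ≤
      (hubbardTorus 2 L 1 U).minEnergyOn (szSector (a + b) (((a : ℝ) - b) / 2)) + μ + 16 * U := by
  set a' : ℕ := if σ = 0 then a + 1 else a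
  set b' : ℕ := if σ = 0 then b else b + 1
  set nσ : ℕ := if σ = 0 then a else b
  set H := hubbardTorus 2 L 1 U
  -- a ground state of the lower sector, and the variational principle on the upper one
  obtain ⟨φ, hφ, hφ0, hHφ'⟩ := (upDownSector_groundState (fermionTorusGraph 2 L) 1 U (a := a) (b := b)
    (by rw [card_fermionTorus]; exact ha) (by rw [card_fermionTorus]; exact hb)).1
  have hHφ : H *ᵥ φ = ((H.minEnergyOn (szSector (a + b) (((a : ℝ) - b) / 2)) : ℝ) : ℂ) • φ := hHφ'
  have hEw : ∀ w : Fock (Orb (FermionTorus 2 L)), IsInSector a' b' w →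
      H.minEnergyOn (szSector (a' + b') (((a' : ℝ) - b') / 2)) * (star w ⬝ᵥ w).re ≤ (star w ⬝ᵥ (H *ᵥ w)).re :=
    fun w hw => UpperSandwich.minEnergyOn_mul_le_re (LiebThm1.hamiltonian_isHermitian (fermionTorusGraph 2 L) 1 U) _
      ((Summit.HubbardSuperconductivity.HubbardSuperconductivity.Theorems.isInSector_iff_mem_szSector a' b' w).1 hw)
  -- the modes below `μ`: `|S| = torusLevelCount L μ ∈ [nσ + L²/256, L²]`
  set S : Finset (TorusSite 2 L) := Finset.univ.filter fun k => torusBand L k ≤ μ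
  have hSle : (S.card : ℝ) ≤ (L : ℝ) ^ 2 := by exact_mod_cast torusLevelCount_le (L := L) μ
  have hroom' : (nσ : ℝ) + (L : ℝ) ^ 2 / 256 ≤ S.card := hroom
  have hL3 : (3 : ℝ) ≤ L := by exact_mod_cast hL
  have hSpos : (0 : ℝ) < S.card := by have h0 : (0 : ℝ) ≤ nσ := Nat.cast_nonneg nσ; nlinarith
  -- pigeonhole: a mode `k` below `μ` with `‖c†_{kσ}φ‖² ≥ (|S| - nσ)/|S| · ‖φ‖² ≥ ‖φ‖²/256`
  obtain ⟨k, hkS, hk⟩ := Finset.exists_le_of_sum_le (Finset.card_pos.1 (by exact_mod_cast hSpos))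
    (f := fun _ => ((S.card : ℝ) - nσ) * (star φ ⬝ᵥ φ).re / S.card)
    (g := fun k => (star (momentumCreation k σ *ᵥ φ) ⬝ᵥ (momentumCreation k σ *ᵥ φ)).re)
    (by rw [Finset.sum_const, nsmul_eq_mul, mul_div_cancel₀ _ hSpos.ne']; exact sum_re_inner_momentumCreation_mulVec_ge hφ σ S)
  have hroomk : (1 / 16 : ℝ) ^ 2 * (star φ ⬝ᵥ φ).re ≤
      (star (momentumCreation k σ *ᵥ φ) ⬝ᵥ (momentumCreation k σ *ᵥ φ)).re := by
    refine le_trans ?_ hk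
    rw [mul_div_right_comm]
    refine mul_le_mul_of_nonneg_right ?_ (Complex.pos_iff.mp (dotProduct_star_self_pos_iff.2 hφ0)).1.le
    rw [le_div_iff₀ hSpos]
    nlinarith
  obtain ⟨τ', hne⟩ : ∃ τ' : Fin 2, τ' ≠ σ := ⟨σ + 1, by fin_cases σ <;> decide⟩
  have hstep := momentum_addition_step hL hU hne k hφ0 hHφ (isInSector_momentumCreation_mulVec hφ k σ) hEw
    (by norm_num : (0 : ℝ) < 1 / 16) hroomk
  have hεk : torusBand L k ≤ μ := (Finset.mem_filter.1 hkS).2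
  have h16 : U / (1 / 16 : ℝ) = 16 * U := by ring
  linarith

end Window

/-- **Registered stub `stub_weakCouplingPairWindow`** of crux `NoOnsiteODLRO` (stmt-HubbardSuperconductivity-0933; a
helper of line `registered`): **the pair chemical-potential window is STRICT at weak coupling.** For every doping
`δ ∈ [1/10, 2/5]` there are `U₁ > 0`, `κ > 0` (namely `κ = -μ₂ = 4 sin²(π/50)`, `U₁ = κ/31`) and `L₀` with
`U - (E(N,0) - E(N-2,0)) ≥ κ` for all `0 ≤ U ≤ U₁`, `L ≥ L₀`, `N = 2⌊(1-δ)L²/2⌋ = 2m + 2`, `H = hubbardTorus 2 L 1 U`: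
below `μ₂` there are `≥ (287/625 - 1/200)L²` Bloch levels for large `L` (Weyl law, `tendsto_torusLevelCount_div_sq`,
`le_volume_real_sublevelCell_hi`) against at most `m ≤ (9/20)L² - 1` electrons per spin, so two Bloch additions
`(m,m) → (m+1,m) → (m+1,m+1)` below `μ₂` (`minEnergyOn_addOne_le_weak`) give `E(N,0) ≤ E(N-2,0) + 2μ₂ + 32U`.
Yang, PRL 63 (1989) 2144; Lieb–Loss–McCann, J. Math. Phys. 34 (1993) 891 (band filling); Tasaki (2020) §2.1. [folklore] -/
theorem stub_weakCouplingPairWindow : ∀ δ : ℝ, δ ∈ Set.Icc (1 / 10 : ℝ) (2 / 5) → ∃ U₁ : ℝ, 0 < U₁ ∧ ∃ κ : ℝ, 0 < κ ∧ ∃ L₀ : ℕ, ∀ (U : ℝ), 0 ≤ U → U ≤ U₁ → ∀ (L : ℕ) [NeZero L], Even L → L₀ ≤ L → κ ≤ U - ((hubbardTorus 2 L 1 U).minEnergyOn (szSector (Λ := FermionTorus 2 L) (2 * ⌊(1 - δ) * (L : ℝ) ^ 2 / 2⌋₊) 0) - (hubbardTorus 2 L 1 U).minEnergyOn (szSector (Λ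 := FermionTorus 2 L) (2 * ⌊(1 - δ) * (L : ℝ) ^ 2 / 2⌋₊ - 2) 0)) := by
  intro δ hδ
  set μ₂ : ℝ := -4 * Real.sin (Real.pi / 50) ^ 2
  have hμ : μ₂ < 0 := energyHi_neg
  -- Pauli room from the Weyl law: `#{k : ε_L(k) ≤ μ₂} > (287/625 - 1/200) L²` for `L ≥ N₀ + 1`
  obtain ⟨N₀, hN₀⟩ := Filter.eventually_atTop.1 ((tendsto_torusLevelCount_div_sq μ₂).eventually_const_lt
    (lt_of_lt_of_le (show (287 / 625 - 1 / 200 : ℝ) < 287 / 625 by norm_num) le_volume_real_sublevelCell_hi))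
  refine ⟨-μ₂ / 31, by linarith, -μ₂, by linarith, max (N₀ + 1) 3, fun U hU0 hU1 L _ _ hL => ?_⟩
  obtain ⟨hLN, hL3⟩ := max_le_iff.1 hL
  obtain ⟨n, rfl⟩ : ∃ n, L = n + 1 := ⟨L - 1, by omega⟩
  have hcount : (287 / 625 - 1 / 200 : ℝ) * ((n + 1 : ℕ) : ℝ) ^ 2 ≤ torusLevelCount (n + 1) μ₂ := by
    have h := hN₀ n (by omega)
    rw [lt_div_iff₀ (by positivity)] at h
    exact h.le
  -- `N = 2(kk-1) + 2`, `kk = ⌊(1-δ)L²/2⌋ ≥ 1`, `kk - 1 ≤ (9/20)L² - 1`; two Bloch additions `(kk-1,kk-1) → (kk,kk-1) → (kk,kk)`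
  set kk : ℕ := ⌊(1 - δ) * ((n + 1 : ℕ) : ℝ) ^ 2 / 2⌋₊
  have hL3r : (3 : ℝ) ≤ ((n + 1 : ℕ) : ℝ) := by exact_mod_cast hL3
  have hk1 : 1 ≤ kk := by
    refine Nat.le_floor ?_
    rw [Nat.cast_one, le_div_iff₀ (by norm_num : (0 : ℝ) < 2)]
    nlinarith [hδ.2]
  have hfl : (kk : ℝ) ≤ (1 - δ) * ((n + 1 : ℕ) : ℝ) ^ 2 / 2 := Nat.floor_le (by nlinarith [hδ.2])
  rw [show 2 * kk - 2 = 2 * (kk - 1) by omega, show 2 * kk = 2 * (kk - 1) + 2 by omega]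
  have hkR : ((kk - 1 : ℕ) : ℝ) = (kk : ℝ) - 1 := by rw [Nat.cast_sub hk1, Nat.cast_one]
  have hm : kk ≤ (n + 1) ^ 2 := by
    exact_mod_cast (show (kk : ℝ) ≤ ((n + 1 : ℕ) : ℝ) ^ 2 by nlinarith [hδ.1])
  have hroom : ((kk - 1 : ℕ) : ℝ) + ((n + 1 : ℕ) : ℝ) ^ 2 / 256 ≤ torusLevelCount (n + 1) μ₂ := by
    rw [hkR]; nlinarith [hδ.1, hcount]
  have h1 := minEnergyOn_addOne_le_weak (n + 1) hL3 hU0 0 (a := kk - 1) (b := kk - 1) (by omega) (by omega) μ₂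
    (by rw [if_pos rfl]; exact hroom)
  have h2 := minEnergyOn_addOne_le_weak (n + 1) hL3 hU0 1 (a := kk - 1 + 1) (b := kk - 1) (by omega) (by omega) μ₂
    (by rw [if_neg one_ne_zero]; exact hroom)
  simp only [if_true, one_ne_zero, if_false] at h1 h2
  have e0 : szSector (Λ := FermionTorus 2 (n + 1)) (kk - 1 + (kk - 1)) ((((kk - 1 : ℕ) : ℝ) - ((kk - 1 : ℕ) : ℝ)) / 2) =
      szSector (2 * (kk - 1)) 0 := by congr 1 <;> ring
  have e1 : szSector (Λ := FermionTorus 2 (n + 1)) (kk - 1 + 1 + (kk - 1)) ((((kk - 1 + 1 : ℕ) : ℝ) - ((kk - 1 : ℕ) : ℝ)) / 2) =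
      szSector (kk - 1 + 1 + (kk - 1)) (1 / 2) := by congr 1; push_cast; ring
  have e2 : szSector (Λ := FermionTorus 2 (n + 1)) (kk - 1 + 1 + (kk - 1 + 1))
      ((((kk - 1 + 1 : ℕ) : ℝ) - ((kk - 1 + 1 : ℕ) : ℝ)) / 2) = szSector (2 * (kk - 1) + 2) 0 := by
    congr 1; ring; rw [sub_self, zero_div]
  rw [e0, e1] at h1; rw [e1, e2] at h2; linarith

end Summit.HubbardSuperconductivity.NoOnsiteODLRO.WeakCoupling

end
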